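import Literature.NumberTheory.GaloisRepresentations.CliffordInducedPrimeIndex
import Mathlib.LinearAlgebra.Eigenspace.Triangularizable
import HarnessLib

/-!
# Clifford: a representation conjugate to its twist by a character of prime order is induced
# (characteristic polynomials; no irreducibility hypothesis)

Helper file 1/2 of the proof of `CyclicDeinductionCarving.InducedPreAvatar` (stmt-Langlands-27505).
`G` a topological group, `φ : H → G` an injective continuous homomorphism with image of prime
index `p`, `χ : G → Aˣ` a character trivial on `φ(H)`, `χ ≠ 1`, `A` an algebraically closed
field, `r : G → GL_n(A)` framed with `P r P⁻¹ = r ⊗ χ` for some `P`.  Then `n = p m` and the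
characteristic polynomials of `r` are those of `Ind_φ s` for a framed `s : H → GL_m(A)` with
`s(h) = 1` whenever `r(φ h) = 1` (`FramedRep.exists_charpoly_eq_charpoly_comp_indMatrix_of_conj_eq_twist'`);
Galois corollary `FramedGaloisRep.exists_charpoly_eq_charpoly_induce_of_conj_eq_twist`.
This generalises the tree's irreducible case
(`Literature.NumberTheory.GaloisRepresentations.CliffordInducedPrimeIndex`).

Proof.  `χ(G) = μ_p` (prime order), pick `g₀` with `χ g₀ = ζ` primitive.  `P r(φ h) = r(φ h) P`
and `P r(g₀) = ζ r(g₀) P`, so `r(g₀)` maps the maximal generalised eigenspace `V(λ)` of `P` onto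
`V(ζ λ)` and `φ(H)` preserves each `V(λ)`.  The eigenvalues fall into `⟨ζ⟩`-orbits
`{λ, ζλ, …, ζ^{p-1}λ}`, i.e. into classes `ν = λ^p ≠ 0`; choosing one `p`-th root `μ_ν` of each
class and putting `U := ⨆_ν V(μ_ν)`, the translates `r(g₀^i) U = ⨆_ν V(ζ^i μ_ν)`, `i < p`, are
independent with sum `Aⁿ` (`Aⁿ = ⊕_λ V(λ)`: `Module.End.iSup_maxGenEigenspace_eq_top`,
`Module.End.independent_maxGenEigenspace`).  In the adapted basis `r` is the induced matrix of
the `U`-block `s` (the `charpoly_comp_indMatrix_eq_of_transversal` pattern of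
`CliffordInducedPrimeIndex`), and `s(h) = 1` when `r(φ h) = 1`.

References: A. H. Clifford, Ann. of Math. 38 (1937) §§1–3; Serre, *Linear representations of
finite groups*, §7.3, §8.1; Arthur–Clozel, Ann. of Math. Stud. 120, Ch. 3 §6 (Lemma 6.3).
-/

noncomputable section

set_option linter.dupNamespace false

open scoped MatrixGroups Matrix
open Literature.NumberTheory.GaloisRepresentations Field

namespace Summit.Langlands.Langlands.Theorems.CyclicDeinduction

universe u u' v

/-! ### Clifford: twist-stable of prime index ⟹ induced, without irreducibility -/

section Framed

variable {G : Type u} {H : Type u'} [Group G] [TopologicalSpace G] [Group H] [TopologicalSpace H]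
  [IsTopologicalGroup H] {A : Type v} [Field A] [TopologicalSpace A] [IsTopologicalRing A] {n : ℕ}

/-- **Twist-stable of prime index ⟹ induced (characteristic polynomials), for an ARBITRARY framed
representation.**  Let `r : G →ₜ* GL_n(A)` be a framed representation over an algebraically closed
topological field `A`, `φ : H →ₜ* G` injective with image `N` of PRIME index `p`, and suppose
`P r P⁻¹ = r ⊗ χ` for some `P ∈ GL_n(A)` and a continuous character `χ ≠ 1` of `G` trivial on `N`.
Then `n = p · m` and there is a framed `s : H →ₜ* GL_m(A)` with
`det(X - r(x)) = det(X - Ind(s)(x))` for every `x ∈ G` and every transversal `t` of `G / N`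
(`indMatrix`, flattened by `Matrix.comp`), and `s` trivial wherever `r ∘ φ` is (so `s` is
unramified wherever `r|_H` is): `Aⁿ = ⊕_{i<p} r(g₀^i) U` for
`U = ⨆_{ν ≠ 0} V(μ_ν)` the sum of the maximal generalised eigenspaces of `P` at chosen `p`-th
roots `μ_ν` of the `ν ≠ 0`, and `s` is the frame of the `N`-representation on `U`.  No
irreducibility or semisimplicity of `r` is assumed (compare
`FramedRep.exists_charpoly_eq_charpoly_comp_indMatrix_of_conj_eq_twist`).
[cite: Clifford1937, §§1–3] [cite: SerreLinearRepresentations1977, §3.3 Thm. 12 (proof), §7.3]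
[cite: ArthurClozelAMS120, Ch. 3 §6] -/
theorem FramedRep.exists_charpoly_eq_charpoly_comp_indMatrix_of_conj_eq_twist' [IsAlgClosed A]
    (r : FramedRep G A n) (φ : H →ₜ* G) (hinj : Function.Injective φ)
    {p : ℕ} (hp : p.Prime) (hφ : φ.toMonoidHom.range.index = p) (χ : G →ₜ* Aˣ)
    (hχ : ∀ h : H, χ (φ h) = 1) (hχ1 : χ ≠ 1) (P : GL (Fin n) A)
    (hP : FramedRep.conj P r = r.twist χ) :
    ∃ (m : ℕ) (s : FramedRep H A m), n = p * m ∧ (∀ h : H, r (φ h) = 1 → s h = 1) ∧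
      ∀ {ι : Type*} [Fintype ι] [DecidableEq ι] (t : ι → G),
        Function.Bijective (fun i => (t i : G ⧸ φ.toMonoidHom.range)) →
        ∀ x : G, FramedRep.charpoly r x =
          (Matrix.comp ι ι (Fin m) (Fin m) A
            (indMatrix φ.toMonoidHom (FramedRep.toMatrixHom s) t x)).charpoly := by
  classical
  haveI : Fact p.Prime := ⟨hp⟩
  set ρ := r.toRepresentation with hρdef
  set N : Subgroup G := φ.toMonoidHom.range with hNdef
  have hinj' : Function.Injective φ.toMonoidHom := hinj
  -- the operator `T = P` and the relation `T (ρ g v) = χ g • ρ g (T v)`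
  set T : Module.End A (Fin n → A) := Matrix.toLin' (P : Matrix (Fin n) (Fin n) A) with hTdef
  have hPr : ∀ g : G, (P : Matrix (Fin n) (Fin n) A) * ((r g : GL (Fin n) A) : Matrix _ _ A) =
      (χ g : A) • (((r g : GL (Fin n) A) : Matrix (Fin n) (Fin n) A) * (P : Matrix _ _ A)) :=
    fun g => by
    have h1 := congrArg
      (fun σ : FramedRep G A n => ((σ g : GL (Fin n) A) : Matrix (Fin n) (Fin n) A)) hP
    simp only [FramedRep.conj_apply, FramedRep.coe_twist_apply, Units.val_mul] at h1
    calc (P : Matrix (Fin n) (Fin n) A) * ((r g : GL (Fin n) A) : Matrix _ _ A)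
        = (P : Matrix (Fin n) (Fin n) A) * ((r g : GL (Fin n) A) : Matrix _ _ A) *
            ((P⁻¹ : GL (Fin n) A) : Matrix _ _ A) * (P : Matrix (Fin n) (Fin n) A) := by
          rw [Units.inv_mul_cancel_right]
      _ = (χ g : A) • ((r g : GL (Fin n) A) : Matrix (Fin n) (Fin n) A) * (P : Matrix _ _ A) := by
          rw [h1]
      _ = (χ g : A) • (((r g : GL (Fin n) A) : Matrix (Fin n) (Fin n) A) * (P : Matrix _ _ A)) :=
          smul_mul_assoc _ _ _
  have hrel : ∀ (g : G) (v : Fin n → A), T (ρ g v) = (χ g : A) • ρ g (T v) := fun g v => by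
    rw [hTdef, Matrix.toLin'_apply, Matrix.toLin'_apply, FramedRep.toRepresentation_apply_apply,
      FramedRep.toRepresentation_apply_apply, Matrix.mulVec_mulVec, hPr, Matrix.smul_mulVec,
      Matrix.mulVec_mulVec]
  -- `T` is injective (it is the linear map of an invertible matrix)
  have hTinj : ∀ v : Fin n → A, T v = 0 → v = 0 := fun v hv => by
    rw [hTdef, Matrix.toLin'_apply] at hv
    rw [← Matrix.one_mulVec v, ← Units.inv_mul P, ← Matrix.mulVec_mulVec, hv, Matrix.mulVec_zero]
  -- `(T - χ g μ)^k (ρ g v) = (χ g)^k • ρ g ((T - μ)^k v)`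
  have hstep : ∀ (g : G) (μ : A) (v : Fin n → A),
      (T - ((χ g : A) * μ) • (1 : Module.End A (Fin n → A))) (ρ g v) =
        (χ g : A) • ρ g ((T - μ • (1 : Module.End A (Fin n → A))) v) := by
    intro g μ v
    simp only [LinearMap.sub_apply, LinearMap.smul_apply, Module.End.one_apply, hrel, map_sub,
      map_smul, smul_sub, mul_smul]
  have hpow : ∀ (g : G) (μ : A) (k : ℕ) (v : Fin n → A),
      ((T - ((χ g : A) * μ) • (1 : Module.End A (Fin n → A))) ^ k) (ρ g v) =
        (χ g : A) ^ k • ρ g (((T - μ • (1 : Module.End A (Fin n → A))) ^ k) v) := by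
    intro g μ k
    induction k with
    | zero => intro v; simp
    | succ k ih =>
      intro v
      calc ((T - ((χ g : A) * μ) • (1 : Module.End A (Fin n → A))) ^ (k + 1)) (ρ g v)
          = ((T - ((χ g : A) * μ) • (1 : Module.End A (Fin n → A))) ^ k)
              ((T - ((χ g : A) * μ) • (1 : Module.End A (Fin n → A))) (ρ g v)) := by
            rw [pow_succ, Module.End.mul_apply]
        _ = (χ g : A) • ((χ g : A) ^ k •
              ρ g (((T - μ • (1 : Module.End A (Fin n → A))) ^ k)
                ((T - μ • (1 : Module.End A (Fin n → A))) v))) := by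
            rw [hstep, map_smul, ih]
        _ = (χ g : A) ^ (k + 1) •
              ρ g (((T - μ • (1 : Module.End A (Fin n → A))) ^ (k + 1)) v) := by
            rw [smul_smul, ← pow_succ', pow_succ (T - μ • (1 : Module.End A (Fin n → A))) k,
              Module.End.mul_apply]
  -- powers of the injective `T` are injective
  have hTpow : ∀ (k : ℕ) (v : Fin n → A), (T ^ k) v = 0 → v = 0 := by
    intro k
    induction k with
    | zero => intro v hv; simpa using hv
    | succ k ih =>
      intro v hv
      rw [pow_succ', Module.End.mul_apply] at hv
      exact ih v (hTinj _ hv)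
  -- `ρ g` maps the maximal generalised eigenspace of `T` at `μ` into the one at `χ(g) μ`
  have hmapE : ∀ (g : G) (μ : A), ∀ v ∈ T.maxGenEigenspace μ,
      ρ g v ∈ T.maxGenEigenspace ((χ g : A) * μ) := by
    intro g μ v hv
    rw [Module.End.mem_maxGenEigenspace] at hv ⊢
    obtain ⟨k, hk⟩ := hv
    exact ⟨k, by rw [hpow, hk, map_zero, smul_zero]⟩
  have hmapE' : ∀ (g : G) (μ : A),
      (T.maxGenEigenspace μ).map (ρ g) ≤ T.maxGenEigenspace ((χ g : A) * μ) := by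
    rintro g μ _ ⟨v, hv, rfl⟩
    exact hmapE g μ v hv
  -- `g₀` with `ζ = χ g₀ ≠ 1`; `N ≤ ker χ` has index `p`, `ζ ^ p = 1`, `ζ` of order `p`
  obtain ⟨g₀, hg₀⟩ : ∃ g₀ : G, χ g₀ ≠ 1 := by
    by_contra! hall
    exact hχ1 (ContinuousMonoidHom.ext hall)
  set ζ : Aˣ := χ g₀ with hζdef
  have hNK : N ≤ χ.toMonoidHom.ker := by
    rintro _ ⟨h, rfl⟩
    exact hχ h
  have hKidx : χ.toMonoidHom.ker.index = p := by
    have hdvd : χ.toMonoidHom.ker.index ∣ p := hφ ▸ Subgroup.index_dvd_of_le hNK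
    rcases (Nat.dvd_prime hp).mp hdvd with h1 | h1
    · exfalso
      rw [Subgroup.index_eq_one] at h1
      exact hg₀ (h1 ▸ Subgroup.mem_top g₀ : g₀ ∈ χ.toMonoidHom.ker)
    · exact h1
  have hζp : ζ ^ p = 1 := by
    have h1 : g₀ ^ p ∈ χ.toMonoidHom.ker := hKidx ▸ Subgroup.pow_index_mem _ g₀
    rw [MonoidHom.mem_ker, map_pow] at h1
    exact h1
  have hζord : orderOf ζ = p := orderOf_eq_prime hζp hg₀
  have hζinj : ∀ i j : Fin p, ζ ^ (i : ℕ) = ζ ^ (j : ℕ) → i = j := fun i j hij => by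
    rw [pow_inj_mod, hζord, Nat.mod_eq_of_lt i.2, Nat.mod_eq_of_lt j.2] at hij
    exact Fin.ext hij
  have hζprim : IsPrimitiveRoot (ζ : A) p := by
    rw [IsPrimitiveRoot.coe_units_iff, ← hζord]
    exact IsPrimitiveRoot.orderOf ζ
  have hζpow_p : ∀ i : ℕ, (((ζ ^ i : Aˣ) : A)) ^ p = 1 := fun i => by
    rw [← Units.val_pow_eq_pow_val, ← pow_mul, mul_comm, pow_mul, hζp, one_pow, Units.val_one]
  -- the transversal `t₀ i = g₀ ^ i`, `i < p`
  set t₀ : Fin p → G := fun i => g₀ ^ (i : ℕ) with ht₀def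
  have hχt₀ : ∀ i : Fin p, χ (t₀ i) = ζ ^ (i : ℕ) := fun i => map_pow χ g₀ i
  haveI : Finite (G ⧸ N) := Nat.finite_of_card_ne_zero (by
    change N.index ≠ 0
    rw [hφ]
    exact hp.ne_zero)
  have ht₀ : Function.Bijective (fun i => (t₀ i : G ⧸ N)) := by
    have hinjt : Function.Injective (fun i => (t₀ i : G ⧸ N)) := fun i j hij => by
      have h1 : (t₀ i)⁻¹ * t₀ j ∈ χ.toMonoidHom.ker := hNK (QuotientGroup.eq.mp hij)
      rw [MonoidHom.mem_ker, map_mul, map_inv, inv_mul_eq_one] at h1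
      exact hζinj i j (by rw [← hχt₀, ← hχt₀]; exact h1)
    refine hinjt.bijective_of_nat_card_le (le_of_eq ?_)
    have h1 : Nat.card (G ⧸ N) = p := hφ
    rw [Nat.card_fin, h1]
  have hi₀ : t₀ ⟨0, hp.pos⟩ = 1 := pow_zero g₀
  -- chosen `p`-th roots `rt ν` of the scalars `ν`
  have hroot : ∀ ν : A, ∃ μ : A, μ ^ p = ν := fun ν => IsAlgClosed.exists_pow_nat_eq ν hp.pos
  choose rt hrt using hroot
  have hrt0 : ∀ ν : {ν : A // ν ≠ 0}, rt ν.1 ≠ 0 := fun ν h =>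
    ν.2 (by rw [← hrt ν.1, h, zero_pow hp.ne_zero])
  -- the family of maximal generalised eigenspaces `E (i, ν) = V(ζ^i · rt ν)`, `ν ≠ 0`
  set J := Fin p × {ν : A // ν ≠ 0}
  set lab : J → A := fun x => ((ζ ^ (x.1 : ℕ) : Aˣ) : A) * rt x.2.1 with hlabdef
  have hlab_pow : ∀ x : J, lab x ^ p = x.2.1 := fun x => by
    rw [hlabdef]
    dsimp only
    rw [mul_pow, hζpow_p, one_mul, hrt]
  have hlabinj : Function.Injective lab := by
    rintro ⟨i, ν⟩ ⟨j, ν'⟩ hx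
    have hνν' : ν = ν' := by
      apply Subtype.ext
      rw [← hlab_pow (i, ν), ← hlab_pow (j, ν'), hx]
    subst hνν'
    have hij : ((ζ ^ (i : ℕ) : Aˣ) : A) = ((ζ ^ (j : ℕ) : Aˣ) : A) :=
      mul_right_cancel₀ (hrt0 ν) hx
    rw [hζinj i j (Units.val_injective hij)]
  set E : J → Submodule A (Fin n → A) := fun x => T.maxGenEigenspace (lab x) with hEdef
  have hE : iSupIndep E := (Module.End.independent_maxGenEigenspace T).comp hlabinj
  -- `U = ⨆_ν V(rt ν)` and its translates `F i = ρ(g₀^i) U ≤ E' i = ⨆_ν V(ζ^i · rt ν)`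
  set U : Submodule A (Fin n → A) :=
    ⨆ ν : {ν : A // ν ≠ 0}, T.maxGenEigenspace (rt ν.1) with hUdef
  set E' : Fin p → Submodule A (Fin n → A) := fun i => ⨆ ν : {ν : A // ν ≠ 0}, E (i, ν)
    with hE'def
  set F : Fin p → Submodule A (Fin n → A) := fun i => U.map (ρ (t₀ i)) with hFdef
  have hHU' : ∀ h : H, U.map (ρ (φ h)) ≤ U := fun h => by
    rw [hUdef, Submodule.map_iSup]
    refine iSup_mono fun ν => ?_
    have h1 := hmapE' (φ h) (rt ν.1)
    rwa [hχ h, Units.val_one, one_mul] at h1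
  have hHU : ∀ (h : H), ∀ v ∈ U, ρ (φ h) v ∈ U := fun h v hv => hHU' h ⟨v, hv, rfl⟩
  have hFE' : ∀ i, F i ≤ E' i := fun i => by
    change U.map (ρ (t₀ i)) ≤ ⨆ ν : {ν : A // ν ≠ 0}, E (i, ν)
    rw [hUdef, Submodule.map_iSup]
    refine iSup_mono fun ν => ?_
    have h1 := hmapE' (t₀ i) (rt ν.1)
    rwa [hχt₀ i] at h1
  have hE' : iSupIndep E' := by
    intro i
    have h1 : E' i ≤ ⨆ x ∈ {x : J | x.1 = i}, E x := by
      change (⨆ ν : {ν : A // ν ≠ 0}, E (i, ν)) ≤ _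
      exact iSup_le fun ν => le_iSup₂ (f := fun (x : J) (_ : x ∈ {x : J | x.1 = i}) => E x)
        ((i, ν) : J) rfl
    have h2 : (⨆ (j) (_ : j ≠ i), E' j) ≤ ⨆ x ∈ {x : J | x.1 ≠ i}, E x := by
      refine iSup₂_le fun j hj => ?_
      change (⨆ ν : {ν : A // ν ≠ 0}, E (j, ν)) ≤ _
      exact iSup_le fun ν => le_iSup₂ (f := fun (x : J) (_ : x ∈ {x : J | x.1 ≠ i}) => E x)
        ((j, ν) : J) hj
    refine Disjoint.mono h1 h2 (hE.disjoint_biSup_biSup ?_)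
    exact Set.disjoint_left.2 fun x hx hx' => hx' hx
  have hF : iSupIndep F := hE'.mono hFE'
  have hF0 : F ⟨0, hp.pos⟩ = U := by
    change U.map (ρ (t₀ ⟨0, hp.pos⟩)) = U
    rw [hi₀, map_one, Module.End.one_eq_id, Submodule.map_id]
  -- spanning: every maximal generalised eigenspace of `T` lies in some `F i`
  have hVle : ∀ μ : A, T.maxGenEigenspace μ ≤ ⨆ i, F i := by
    intro μ
    by_cases hμ : μ = 0
    · -- `V(0) = 0` since `T` is injective
      intro v hv
      rw [hμ, Module.End.mem_maxGenEigenspace] at hv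
      obtain ⟨k, hk⟩ := hv
      rw [zero_smul, sub_zero] at hk
      have hv0 : v = 0 := hTpow k v hk
      rw [hv0]
      exact Submodule.zero_mem _
    · -- `μ = ζ^i · rt ν` for `ν = μ^p ≠ 0`
      have hν : μ ^ p ≠ 0 := pow_ne_zero p hμ
      set ν : {ν : A // ν ≠ 0} := ⟨μ ^ p, hν⟩ with hνdef
      have hq : (μ * (rt ν.1)⁻¹) ^ p = 1 := by
        rw [mul_pow, inv_pow, hrt, hνdef]
        exact mul_inv_cancel₀ hν
      obtain ⟨i, hi, hζi⟩ := hζprim.eq_pow_of_pow_eq_one hq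
      have hμeq : μ = ((ζ ^ i : Aˣ) : A) * rt ν.1 := by
        rw [Units.val_pow_eq_pow_val, hζi, inv_mul_cancel_right₀ (hrt0 ν)]
      intro v hv
      refine Submodule.mem_iSup_of_mem (⟨i, hi⟩ : Fin p) ?_
      change v ∈ U.map (ρ (t₀ ⟨i, hi⟩))
      -- `w = ρ (g₀^i)⁻¹ v ∈ V(rt ν) ≤ U` and `ρ (g₀^i) w = v`
      have hw : ρ (t₀ ⟨i, hi⟩)⁻¹ v ∈ T.maxGenEigenspace (rt ν.1) := by
        have h1 := hmapE (t₀ ⟨i, hi⟩)⁻¹ μ v hv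
        rwa [map_inv, hχt₀, hμeq, Units.inv_mul_cancel_left] at h1
      refine ⟨ρ (t₀ ⟨i, hi⟩)⁻¹ v, ?_, ?_⟩
      · exact Submodule.mem_iSup_of_mem ν hw
      · rw [← Module.End.mul_apply, ← map_mul, mul_inv_cancel, map_one, Module.End.one_apply]
  have hFsup : ⨆ i, F i = ⊤ := by
    rw [eq_top_iff, ← Module.End.iSup_maxGenEigenspace_eq_top T]
    exact iSup_le hVle
  have hint : DirectSum.IsInternal F :=
    DirectSum.isInternal_submodule_of_iSupIndep_of_iSup_eq_top hF hFsup
  -- the `H`-representation on `U`, continuous for the subspace (= module) topology, and its frame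
  let W : Subrepresentation (ρ.comp φ.toMonoidHom) := ⟨U, fun h v hv => hHU h v hv⟩
  haveI : IsModuleTopology A U := TwistedSum.isModuleTopology_submodule_pi U
  let σU : ContinuousRep H A U := ⟨W.toRepresentation, by
    rw [Topology.IsInducing.subtypeVal.continuous_iff]
    change Continuous fun q : H × U =>
      ((r (φ q.1) : GL (Fin n) A) : Matrix (Fin n) (Fin n) A).mulVec (q.2 : Fin n → A)
    exact ((Units.continuous_val.comp ((map_continuous r).comp
      ((map_continuous φ).comp continuous_fst))).matrix_mulVec
      (continuous_subtype_val.comp continuous_snd))⟩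
  set m := Module.finrank A U with hmdef
  let bU : Module.Basis (Fin m) A U := Module.finBasis A U
  let s : FramedRep H A m := σU.frame bU
  have hs_coe : ∀ h : H, ((s h : GL (Fin m) A) : Matrix (Fin m) (Fin m) A) =
      LinearMap.toMatrix bU bU (W.toRepresentation h) := fun h => rfl
  -- the adapted basis `B (i, a) = ρ (t₀ i) (bU a)` of `V = ⊕ᵢ F i`
  let eU : ∀ i : Fin p, U ≃ₗ[A] F i := fun i =>
    Submodule.equivMapOfInjective (ρ (t₀ i))
      (Literature.RepresentationTheory.Semisimple.rep_apply_injective ρ (t₀ i)) U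
  let B : Module.Basis (Fin p × Fin m) A (Fin n → A) :=
    (hint.collectedBasis fun i => bU.map (eU i)).reindex (Equiv.sigmaEquivProd (Fin p) (Fin m))
  have hB : ∀ (i : Fin p) (a : Fin m), B (i, a) = ρ (t₀ i) (bU a : Fin n → A) := by
    intro i a
    simp only [B, eU, Module.Basis.reindex_apply, hint.collectedBasis_coe, Module.Basis.map_apply]
    exact Submodule.coe_equivMapOfInjective_apply _ _ _ _
  refine ⟨m, s, ?_, ?_, ?_⟩
  · -- `n = p m`
    have h := Module.finrank_eq_card_basis B
    rwa [Module.finrank_fin_fun, Fintype.card_prod, Fintype.card_fin, Fintype.card_fin] at h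
  · -- `s` is trivial wherever `r ∘ φ` is (it is the restriction of `r ∘ φ` to `U`)
    intro h hh
    apply Units.ext
    rw [hs_coe, Units.val_one]
    have hW : W.toRepresentation h = LinearMap.id := by
      refine LinearMap.ext fun u => Subtype.ext ?_
      change ρ (φ h) (u : Fin n → A) = u
      rw [FramedRep.toRepresentation_apply_apply, hh, Units.val_one, Matrix.one_mulVec]
    rw [hW, LinearMap.toMatrix_id]
  · -- characteristic polynomials
    have hcol : ∀ (h : H) (b : Fin m),
        ρ (φ.toMonoidHom h) (bU b : Fin n → A) =
          ∑ c, (FramedRep.toMatrixHom s h) c b • (bU c : Fin n → A) := by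
      intro h b
      rw [FramedRep.toMatrixHom_apply, hs_coe]
      have h1 : W.toRepresentation h (bU b) =
          ∑ c, (LinearMap.toMatrix bU bU (W.toRepresentation h)) c b • bU c := by
        conv_lhs => rw [← Matrix.toLin_toMatrix bU bU (W.toRepresentation h)]
        rw [Matrix.toLin_self]
      have h2 : ρ (φ h) (bU b : Fin n → A) = ((W.toRepresentation h (bU b) : U) : Fin n → A) :=
        rfl
      change ρ (φ h) (bU b : Fin n → A) = _
      rw [h2, h1]
      simp
    intro ι _ _ t ht x
    rw [charpoly_comp_indMatrix_eq_of_transversal hinj' (FramedRep.toMatrixHom s) ht₀ ht x,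
      ← Representation.toMatrix_eq_comp_indMatrix ρ hinj' ht₀ (fun a => (bU a : Fin n → A))
        (FramedRep.toMatrixHom s) hcol B hB x,
      LinearMap.charpoly_toMatrix, FramedRep.charpoly_eq_charpoly_toRepresentation]

end Framed

/-! ### Galois representations: layers of prime degree -/

section Galois

open Field

/-- **Twist-stable Galois representations along a layer of prime degree are induced
(characteristic polynomials).**  Let `L/K` be an extension of number fields of prime degree
`p = [L : K]`, `A` an algebraically closed topological field, `r : Γ_K → GL_n(A)` ANY framed
Galois representation, and `χ ≠ 1` a continuous character of `Γ_K` trivial on `res(Γ_L)` (for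
`L/K` cyclic: a generator of the character group of `Gal(L/K)`) with `P r P⁻¹ = r ⊗ χ` for some
`P ∈ GL_n(A)`.  Then `n = p · m` and there is a framed `s : Γ_L → GL_m(A)` with
`det(X - r(σ)) = det(X - Ind_{Γ_L}^{Γ_K}(s)(σ))` for every `σ ∈ Γ_K` (`FramedGaloisRep.induce`),
i.e. `r ≅ Ind_{Γ_L}^{Γ_K} s` at the level of characteristic polynomials — hence of traces,
determinants and Frobenius data; moreover `s` is trivial wherever `r|_{Γ_L}` is (so `s` is
unramified at every place of `L` at which `r|_{Γ_L}` is).  This is the Galois side of Arthur–Clozel's Lemma 6.3 / Thm. 6.2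
(a representation fixed by `⊗ η_{L/K}` is induced from `L`), with no irreducibility or
semisimplicity hypothesis on `r`.  Proof:
`FramedRep.exists_charpoly_eq_charpoly_comp_indMatrix_of_conj_eq_twist'` with
`[Γ_K : res Γ_L] = [L : K]` (`nat_card_quotient_range_absGaloisRestrict`); the transversal chosen
by `induce` is immaterial (`FramedGaloisRep.charpoly_induce_eq_charpoly_comp_indMatrix`).
[cite: ArthurClozelAMS120, Ch. 3 §6, Lemma 6.3] [cite: Clifford1937, §§1–3] -/
theorem FramedGaloisRep.exists_charpoly_eq_charpoly_induce_of_conj_eq_twist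
    (K L : Type) [Field K] [NumberField K] [Field L] [NumberField L] [Algebra K L]
    (hp : (Module.finrank K L).Prime) {A : Type} [Field A] [TopologicalSpace A]
    [IsTopologicalRing A] [IsAlgClosed A] {n : ℕ} (r : FramedGaloisRep K A n)
    (χ : absoluteGaloisGroup K →ₜ* Aˣ)
    (hχ : ∀ τ : absoluteGaloisGroup L, χ (absGaloisRestrict K L τ) = 1) (hχ1 : χ ≠ 1)
    (P : GL (Fin n) A) (hP : FramedRep.conj P r = FramedRep.twist r χ) :
    ∃ (m : ℕ) (s : FramedGaloisRep L A m), n = Module.finrank K L * m ∧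
      (∀ τ : absoluteGaloisGroup L, r (absGaloisRestrict K L τ) = 1 → s τ = 1) ∧
      ∀ σ : absoluteGaloisGroup K,
        FramedRep.charpoly r σ =
          FramedRep.charpoly (s.induce K (rfl : Module.finrank K L = Module.finrank K L)) σ := by
  haveI : FiniteDimensional K L := Module.Finite.of_restrictScalars_finite ℚ K L
  have hidx : (absGaloisRestrict K L).toMonoidHom.range.index = Module.finrank K L :=
    nat_card_quotient_range_absGaloisRestrict K L
  obtain ⟨m, s, hm, hker, hchar⟩ :=
    FramedRep.exists_charpoly_eq_charpoly_comp_indMatrix_of_conj_eq_twist' r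
      (absGaloisRestrict K L) (absGaloisRestrict_injective K L) hp hidx χ hχ hχ1 P hP
  refine ⟨m, s, hm, hker, fun σ => ?_⟩
  rw [FramedGaloisRep.charpoly_induce_eq_charpoly_comp_indMatrix K rfl s σ]
  exact hchar (absGaloisCosetRep K L rfl) (absGaloisCosetRep_bijective K L rfl) σ

end Galois

end Summit.Langlands.Langlands.Theorems.CyclicDeinduction

end
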